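import Summits.QuantumFields.YangMills.Theses.RecentredCoverTransfer
import HarnessLib

/-!
# Route `RecentredCoverTransfer` (LINE g9-B of planner ym-idea-1, «restrict-then-tighten» INSIDE the commonly-centred transfer),
# glue item `CommonCentredOfTruncation` (stmt-QuantumFields-23110), PROVED

`TruncatedLinearTransfer → UniformSecondMoments → CommonCentredCoverTransfer`.

Proof (the planner's docstring, verbatim in substance).
1. IDENTIFICATION: the checkerboard-cell distribution `(C k).dist ρ β (a•) F_curv m_T n F` and the straight-torus distribution
   `latticeDist ρ β L a F_curv m_T n F` are the integrals of the explicit cylinder polynomials `p^C_k`, `p^T_k` of the two children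
   (`PeriodCell.dist_apply` / `latticeDist_apply`, the moments are integrals of bounded measurable products, `integral_finsetSum`,
   `integral_complex_ofReal`).
2. TRUNCATION IN `L²`: for `M > 0` and `T_M z = z·1{‖z‖ ≤ M}`, pointwise `‖z − T_M z‖ ≤ ‖z‖²/M`, hence
   `‖∫ p − ∫ T_M∘p‖ ≤ (∫ ‖p‖²)/M ≤ B/M` on each side (`UniformSecondMoments` supplies `B`).
3. `ε/2 + ε/2`: with `M := 8B/ε + 1`, `TruncatedLinearTransfer` at that `M` makes the truncated difference `< ε/2` eventually.

Pure measure theory / bookkeeping; width seat `ym-line-sfw-p2-w2` g22 (cell ym-idea-1, free hands).  HONEST FRAMING: the two children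
`TruncatedLinearTransfer` (23108, the IR wall in merging currency) and `UniformSecondMoments` (23109) are OPEN; this glue proves no crux,
no rung (R2d ROT) and no summit. [folklore]
-/

set_option autoImplicit false

noncomputable section

open scoped BigOperators SchwartzMap
open MeasureTheory Filter Topology
open Literature.MathematicalPhysics.QuantumFieldTheory Literature.MathematicalPhysics.QuantumLattice
open Literature.MathematicalPhysics.AQFT
open Literature.Probability.LatticeModels (box Site)
open Summit.QuantumFields.YangMills.Theorems.ROT
open Summit.QuantumFields.YangMills.Theorems.OSLegsFromFemtoAndGap (torusMoment latticeDist latticeDist_apply)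

namespace Summit.QuantumFields.YangMills.Theorems.RecentredCoverTransfer

/-! ## §1 Truncation in `L²` -/

/-- Pointwise truncation tail: `‖z − T_M z‖ ≤ ‖z‖²/M` for `M > 0`, `T_M z = z·1{‖z‖ ≤ M}`. [folklore] -/
theorem norm_sub_trunc_le {E : Type*} [NormedAddCommGroup E] (z : E) {M : ℝ} (hM : 0 < M) :
    ‖z - (if ‖z‖ ≤ M then z else 0)‖ ≤ ‖z‖ ^ 2 / M := by
  split_ifs with h
  · rw [sub_self, norm_zero]; positivity
  · rw [sub_zero, le_div_iff₀ hM, sq]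
    exact mul_le_mul_of_nonneg_left (not_le.mp h).le (norm_nonneg _)

/-- **`L²` truncation**: if `∫ ‖p‖² ≤ B` then `‖∫ p − ∫ T_M∘p‖ ≤ B/M`. [folklore] -/
theorem norm_integral_sub_integral_trunc_le {Ω : Type*} [MeasurableSpace Ω] {μ : Measure Ω} [IsFiniteMeasure μ]
    {p : Ω → ℂ} (hp : MemLp p 2 μ) {B : ℝ} (hB : ∫ ω, ‖p ω‖ ^ 2 ∂μ ≤ B) {M : ℝ} (hM : 0 < M) :
    ‖(∫ ω, p ω ∂μ) - ∫ ω, (fun z : ℂ => if ‖z‖ ≤ M then z else 0) (p ω) ∂μ‖ ≤ B / M := by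
  have hpi : Integrable p μ := hp.integrable one_le_two
  have hT_meas : Measurable (fun z : ℂ => if ‖z‖ ≤ M then z else 0) :=
    Measurable.ite (measurableSet_le continuous_norm.measurable measurable_const) measurable_id measurable_const
  have hTp_int : Integrable (fun ω => (fun z : ℂ => if ‖z‖ ≤ M then z else 0) (p ω)) μ := by
    refine Integrable.of_bound (hT_meas.comp_aemeasurable hpi.aemeasurable).aestronglyMeasurable M ?_
    refine Eventually.of_forall fun ω => ?_
    show ‖(if ‖p ω‖ ≤ M then p ω else 0)‖ ≤ M
    split_ifs with h
    · exact h
    · rw [norm_zero]; exact hM.le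
  have h2 : Integrable (fun ω => ‖p ω‖ ^ 2) μ := (memLp_two_iff_integrable_sq_norm hp.1).mp hp
  rw [← integral_sub hpi hTp_int]
  calc ‖∫ ω, (p ω - (fun z : ℂ => if ‖z‖ ≤ M then z else 0) (p ω)) ∂μ‖
      ≤ ∫ ω, ‖p ω - (fun z : ℂ => if ‖z‖ ≤ M then z else 0) (p ω)‖ ∂μ := norm_integral_le_integral_norm _
    _ ≤ ∫ ω, ‖p ω‖ ^ 2 / M ∂μ :=
        integral_mono_of_nonneg (Eventually.of_forall fun _ => norm_nonneg _) (h2.div_const M)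
          (Eventually.of_forall fun ω => norm_sub_trunc_le (p ω) hM)
    _ = (∫ ω, ‖p ω‖ ^ 2 ∂μ) / M := integral_div M _
    _ ≤ B / M := div_le_div_of_nonneg_right hB hM.le

/-- **The `ε/2 + ε/2` step**: if for every `M > 0` some sequence `t` tends to `0` with `‖d k − t k‖ ≤ 2B/M` for all `k`, then
`d → 0`. [folklore] -/
theorem tendsto_zero_of_trunc {d : ℕ → ℂ} {B : ℝ} (hB : 0 ≤ B)
    (h : ∀ M : ℝ, 0 < M → ∃ t : ℕ → ℂ, Tendsto t atTop (nhds 0) ∧ ∀ k, ‖d k - t k‖ ≤ 2 * B / M) :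
    Tendsto d atTop (nhds 0) := by
  rw [Metric.tendsto_atTop]
  intro ε hε
  obtain ⟨t, ht, hdt⟩ := h (8 * B / ε + 1) (by positivity)
  rw [Metric.tendsto_atTop] at ht
  obtain ⟨N, hN⟩ := ht (ε / 2) (by positivity)
  refine ⟨N, fun k hk => ?_⟩
  have h1 := hdt k
  have h2 := hN k hk
  rw [dist_zero_right] at h2 ⊢
  have h3 : 2 * B / (8 * B / ε + 1) ≤ ε / 4 := by
    rw [div_le_iff₀ (by positivity)]
    have : ε / 4 * (8 * B / ε + 1) = 2 * B + ε / 4 := by field_simp; ring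
    rw [this]; linarith
  calc ‖d k‖ = ‖(d k - t k) + t k‖ := by rw [sub_add_cancel]
    _ ≤ ‖d k - t k‖ + ‖t k‖ := norm_add_le _ _
    _ < ε / 4 + ε / 2 := add_lt_add_of_le_of_lt (h1.trans h3) h2
    _ ≤ ε := by linarith

/-! ## §2 Identification of the two distributions with integrals of the cylinder polynomials -/

section Identification

variable {G : Type} [Group G] [TopologicalSpace G] [IsTopologicalGroup G] [CompactSpace G]
  [MeasurableSpace G] [BorelSpace G]

omit [Group G] [TopologicalSpace G] [IsTopologicalGroup G] [CompactSpace G] [BorelSpace G] in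
/-- The periodic lift of a period cell is measurable (coordinatewise evaluation). [folklore] -/
theorem measurable_lift (C : PeriodCell 4) : Measurable (C.lift (G := G)) :=
  measurable_pi_lambda _ fun _ => measurable_pi_apply _

/-- Integrability of the centred products on a checkerboard cell, for a bounded measurable species. [folklore] -/
theorem integrable_prod_cell (C : PeriodCell 4) (r : LatticeRep G) (β : ℝ) (s : YMSpecies G) (m : ℝ) {n : ℕ}
    (x : Fin n → Site 4) :
    Integrable (fun U : C.Config G => ∏ i, (s.F (configShift (-(x i)) (C.lift U)) - m)) (C.measure (G := G) r.ρ β) := by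
  haveI := C.isProbabilityMeasure_measure (G := G) r.ρ r.continuous β
  obtain ⟨B, hB⟩ := s.bounded
  have hmeas : ∀ i, Measurable fun U : C.Config G => s.F (configShift (-(x i)) (C.lift U)) - m := fun i =>
    (s.measurable.comp ((configShift _).measurable.comp (measurable_lift C))).sub measurable_const
  refine Integrable.of_bound (Finset.measurable_prod _ fun i _ => hmeas i).aestronglyMeasurable ((|B| + |m|) ^ n) ?_
  refine Eventually.of_forall fun U => ?_
  rw [Real.norm_eq_abs, Finset.abs_prod]
  calc ∏ i, |s.F (configShift (-(x i)) (C.lift U)) - m|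
      ≤ ∏ _i : Fin n, (|B| + |m|) := Finset.prod_le_prod (fun _ _ => abs_nonneg _) fun i _ =>
        (abs_sub _ _).trans (add_le_add ((hB _).trans (le_abs_self B)) le_rfl)
    _ = (|B| + |m|) ^ n := by simp

/-- **Cell side**: the `n`-point distribution of a period cell is the integral of the smeared centred cylinder polynomial. [folklore] -/
theorem dist_eq_integral_sum (C : PeriodCell 4) (r : LatticeRep G) (β : ℝ) (A : Site 4 → EuclideanSpace ℝ (Fin 4))
    (s : YMSpecies G) (m : ℝ) (n : ℕ) (F : 𝓢((Fin n → EuclideanSpace ℝ (Fin 4)), ℂ)) :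
    C.dist (G := G) r.ρ β A s.F m n F =
      ∫ U, ∑ x ∈ Fintype.piFinset (fun _ : Fin n => C.reps),
        ((∏ i, (s.F (configShift (-(x i)) (C.lift U)) - m) : ℝ) : ℂ) * F (fun i => A (x i)) ∂(C.measure (G := G) r.ρ β) := by
  rw [PeriodCell.dist_apply]
  rw [integral_finsetSum _ (fun x _ => ((integrable_prod_cell C r β s m x).ofReal).mul_const _)]
  refine Finset.sum_congr rfl fun x _ => ?_
  rw [integral_mul_const, integral_complex_ofReal]
  rfl

/-- **Torus side**: the lattice `n`-point distribution is the integral of the smeared centred cylinder polynomial. [folklore] -/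
theorem latticeDist_eq_integral_sum (r : LatticeRep G) (β : ℝ) (L : ℕ) (a : ℝ) (s : YMSpecies G) (m : ℝ) (n : ℕ)
    (F : 𝓢((Fin n → EuclideanSpace ℝ (Fin 4)), ℂ)) :
    latticeDist r.ρ β L a s.F m n F =
      ∫ U, ∑ x ∈ Fintype.piFinset (fun _ : Fin n => box 4 L),
        ((∏ i, (s.F (configShift (-(x i)) (torusLift (2 * L + 1) U)) - m) : ℝ) : ℂ) * F (fun i => a • siteToE (x i))
        ∂(wilsonMeasure (d := 4) (L := 2 * L + 1) r.ρ β) := by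
  rw [latticeDist_apply]
  rw [integral_finsetSum _ (fun x _ =>
    ((Summit.QuantumFields.YangMills.Theorems.OSLegsFromFemtoAndGap.integrable_prod_obs r β L s m x).ofReal).mul_const _)]
  refine Finset.sum_congr rfl fun x _ => ?_
  rw [integral_mul_const, integral_complex_ofReal]
  rfl

end Identification

/-! ## §3 The glue -/

/-- **`CommonCentredOfTruncation` (stmt-QuantumFields-23110):** `TruncatedLinearTransfer → UniformSecondMoments →
CommonCentredCoverTransfer` — identification, `L²` truncation at level `M`, and `ε/2 + ε/2`. [folklore] -/
theorem commonCentredOfTruncation_proof :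
    Summit.QuantumFields.YangMills.Theses.RecentredCoverTransfer.CommonCentredOfTruncation := by
  intro hT hU G _ _ _ _ hG
  letI : MeasurableSpace G := borel G
  haveI : BorelSpace G := ⟨rfl⟩
  intro r a ha ha0 hMB sch hsch C hC n hn F hF hFc
  obtain ⟨B, hB⟩ := hU G hG r a ha ha0 hMB sch hsch C hC n hn F hF hFc
  have hTM := fun (M : ℝ) (hM : 0 < M) => hT G hG r a ha ha0 hMB sch hsch C hC n hn F hF hFc M hM
  haveI hprobC : ∀ k, IsProbabilityMeasure ((C k).measure (G := G) r.ρ (sch.β k)) := fun k =>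
    (C k).isProbabilityMeasure_measure (G := G) r.ρ r.continuous _
  haveI hprobT : ∀ k, IsProbabilityMeasure (wilsonMeasure (d := 4) (L := 2 * sch.L k + 1) r.ρ (sch.β k)) := fun k =>
    isProbabilityMeasure_wilsonMeasure (d := 4) (L := 2 * sch.L k + 1) r.ρ r.continuous _
  have hB0 : 0 ≤ B := le_trans (integral_nonneg fun _ => by positivity) (hB 0).2.1
  refine tendsto_zero_of_trunc hB0 fun M hM => ⟨_, hTM M hM, fun k => ?_⟩
  beta_reduce
  rw [dist_eq_integral_sum (C k) r (sch.β k) (fun z => (sch.a k) • siteToE z) r.curvature _ n F,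
    latticeDist_eq_integral_sum r (sch.β k) (sch.L k) (sch.a k) r.curvature _ n F]
  rw [sub_sub_sub_comm]
  refine (norm_sub_le _ _).trans ?_
  have e : B / M + B / M = 2 * B / M := by ring
  rw [← e]
  exact add_le_add (norm_integral_sub_integral_trunc_le (hB k).1 (hB k).2.1 hM)
    (norm_integral_sub_integral_trunc_le (hB k).2.2.1 (hB k).2.2.2 hM)

end Summit.QuantumFields.YangMills.Theorems.RecentredCoverTransfer

end
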